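import Literature.NumberTheory.ModularForms.ModularCurveDifferentialsPullback
import Literature.NumberTheory.Automorphic.FuchsianEichlerShimuraWeightTwo
import HarnessLib

/-!
# Holomorphic differentials on `X(Γ)` are weight-two CUSP forms on `Γ`: vanishing at the cusps
# (Shimura §2.1 Prop. 2.16; Diamond–Shurman §3.3)

Layer `Literature/NumberTheory/ModularForms`, namespace `Literature.NumberTheory.ModularForms.ModularCurve`;
sequel of `ModularCurveDifferentialsPullback` (the development `F` of a holomorphic `1`-form `ω` of `X(Γ)`
along `inl ∘ π`, `f = dF∕dz` holomorphic, weight-two `Γ`-invariant, `f = 0 ⇒ ω = 0`). G. Shimura, *Introduction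
to the arithmetic theory of automorphic functions* (1971), §2.1 Prop. 2.16: the differentials holomorphic at a
cusp `s` are the forms `f` with `f ∣[2] σ → 0` at `i∞` (`σ∞ = s`): in the local parameter `q = e^{2πi σ⁻¹z}` one
has `f(σw) d(σw) = ω_q dq = ω_q · 2πi q dw`. F. Diamond, J. Shurman, GTM 228, §3.3 («`Ω¹_hol(X(Γ)) ≅ S₂(Γ)`»).

* `hasDerivAt_comp_smul`, `slash_two_apply_of_det` — `(f ∣[2] σ)(w) = d/dw F(σw)` for `det σ = 1`;
* `hasDerivAt_qParam_one`, `toCpt_frameGL_smul_eq_symm_qParam`, `hasDerivAt_primitive_comp_frame` — along the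
  frame `σ_i`, a primitive `G` of `ω` near the cusp reads `G(π(σ_i w)) = (G ∘ q_i⁻¹)(e^{2πiw})` with derivative
  `ω_{q_i}(e^{2πiw}) · 2πi e^{2πiw}`;
* ★ `isZeroAtImInfty_devDeriv_slash_frameGL` — **`f ∣[2] σ_i → 0` at `i∞`** (`ω_{q_i}` is analytic, hence
  bounded, at `q = 0`);
* ★ `cuspFormOfDevelopment` — **THE PULL-BACK `Ω¹(X(Γ)) → S₂(Γ)`** as a Mathlib `CuspForm (↑Γ) 2` (every cusp of
  `Γ` is `γσ_i∞`, `isZeroAt_iff`); `rePeriod_cuspFormOfDevelopment` (`Re ∫_{z₀}^{γz₀} f = Re(F(γz₀) − F(z₀))`),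
  `eq_zero_of_cuspFormOfDevelopment_eq_zero` (injective).

Everything is proved; one definition (`cuspFormOfDevelopment`).

## References

* G. Shimura, *Introduction to the arithmetic theory of automorphic functions* (1971), §2.1 Prop. 2.16, §1.3–1.5. [ShimuraIATAF1971]
* F. Diamond, J. Shurman, *A first course in modular forms*, GTM 228 (2005), §3.3. [DiamondShurman2005]
-/

noncomputable section

open scoped MatrixGroups Pointwise Topology Manifold ContDiff ModularForm Real
open Set Filter Function UpperHalfPlane Complex
open Literature.Geometry.Kaehler Literature.Geometry.Kaehler.RiemannSurface
open Literature.NumberTheory.Automorphic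

namespace Literature.NumberTheory.ModularForms

namespace ModularCurve

variable {Γ : Subgroup SL(2, ℤ)} [Γ.FiniteIndex] [IsCancelSMul (Γ : Subgroup (GL (Fin 2) ℝ)) ℍ]
variable {θ : MeromorphicOneForm (Cpt Γ)} {F : ℍ → ℂ}

/-! ### The slash of `dF∕dz` by `σ` is the derivative of `F ∘ σ` -/

/-- **Chain rule**: `d/dw F(g·w) = F′(g w) · det g ∕ (cw + d)²` for `det g > 0`. [cite: ShimuraIATAF1971, §2.1] -/
theorem hasDerivAt_comp_smul (hF : θ.IsDevelopment (toCpt Γ) F) {g : GL (Fin 2) ℝ} (hg : 0 < g.val.det) {z : ℂ} (hz : 0 < z.im) :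
    HasDerivAt (fun w : ℂ => F (g • UpperHalfPlane.ofComplex w))
      (devDeriv F (g • UpperHalfPlane.ofComplex z) * (g.val.det / denom g (UpperHalfPlane.ofComplex z) ^ 2)) z := by
  set τ : ℍ := UpperHalfPlane.ofComplex z with hτ
  have hzτ : (τ : ℂ) = z := by rw [hτ, UpperHalfPlane.ofComplex_apply_of_im_pos hz, UpperHalfPlane.coe_mk]
  have hγτ : 0 < (((g • τ : ℍ)) : ℂ).im := (g • τ).im_pos
  have h1 : HasDerivAt (fun w : ℂ => (((g • UpperHalfPlane.ofComplex w : ℍ)) : ℂ)) (g.val.det / denom g τ ^ 2) z := by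
    rw [← hzτ]
    exact (UpperHalfPlane.hasStrictDerivAt_smul hg τ).hasDerivAt
  have h2 : HasDerivAt (F ∘ UpperHalfPlane.ofComplex) (devDeriv F (g • τ))
      ((fun w : ℂ => (((g • UpperHalfPlane.ofComplex w : ℍ)) : ℂ)) z) := by
    have h := hasDerivAt_of_isDevelopment hF hγτ
    rw [UpperHalfPlane.ofComplex_apply] at h
    exact h
  have h3 := h2.comp z h1
  refine h3.congr_of_eventuallyEq ?_
  filter_upwards with w
  simp only [comp_apply, UpperHalfPlane.ofComplex_apply]

omit [Γ.FiniteIndex] [IsCancelSMul (Γ : Subgroup (GL (Fin 2) ℝ)) ℍ] in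
/-- **The weight-two slash for `det g = 1`**: `(f ∣[2] g)(τ) = f(gτ) · det g ∕ (cτ + d)²`. [cite: ShimuraIATAF1971, §2.1 (2.1.4)] -/
theorem slash_two_apply_of_det (f : ℍ → ℂ) {g : GL (Fin 2) ℝ} (hg : g.det = 1) (τ : ℍ) :
    (f ∣[(2 : ℤ)] g) τ = f (g • τ) * (g.val.det / denom g τ ^ 2) := by
  have hdet' : 0 < g.det.val := by rw [hg, Units.val_one]; exact one_pos
  have hval : g.val.det = 1 := by rw [← Matrix.GeneralLinearGroup.val_det_apply, hg, Units.val_one]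
  rw [ModularForm.slash_apply]
  have hσ : ∀ w : ℂ, UpperHalfPlane.σ g w = w := fun w => by rw [UpperHalfPlane.σ, if_pos hdet']; rfl
  have habs : |g.det.val| = 1 := by rw [hg, Units.val_one, abs_one]
  rw [hσ, habs, hval]
  have hden : denom g τ ≠ 0 := denom_ne_zero _ _
  simp only [Complex.ofReal_one, one_zpow, mul_one, zpow_neg, zpow_two]
  field_simp

/-- **`(dF∕dz ∣[2] σ)(w) = d/dw F(σw)`** for `det σ = 1`. [cite: ShimuraIATAF1971, §2.1 Prop. 2.16 (proof)] -/
theorem hasDerivAt_comp_smul_slash (hF : θ.IsDevelopment (toCpt Γ) F) {g : GL (Fin 2) ℝ} (hg : g.det = 1) {z : ℂ} (hz : 0 < z.im) :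
    HasDerivAt (fun w : ℂ => F (g • UpperHalfPlane.ofComplex w)) ((devDeriv F ∣[(2 : ℤ)] g) (UpperHalfPlane.ofComplex z)) z := by
  have hval : 0 < g.val.det := by
    rw [← Matrix.GeneralLinearGroup.val_det_apply, hg, Units.val_one]; exact one_pos
  rw [slash_two_apply_of_det _ hg]
  exact hasDerivAt_comp_smul hF hval hz

/-! ### Near a cusp: primitives read in the `q`-coordinate -/

omit [Γ.FiniteIndex] [IsCancelSMul (Γ : Subgroup (GL (Fin 2) ℝ)) ℍ] in
/-- `d/dz e^{2πiz} = 2πi e^{2πiz}` (private twin of the tree's `hasDerivAt_qParam` in `EllipticCurves/ModularFormsRamanujan`,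
whose import closure is not wanted here). [folklore] -/
private theorem hasDerivAt_qParam_one (z : ℂ) :
    HasDerivAt (Function.Periodic.qParam 1) (2 * π * Complex.I * Function.Periodic.qParam 1 z) z := by
  have h : HasDerivAt (fun w : ℂ => 2 * π * Complex.I * w / 1) (2 * π * Complex.I) z := by
    simpa using ((hasDerivAt_id z).const_mul (2 * π * Complex.I)).div_const (1 : ℂ)
  have h2 : HasDerivAt (fun w : ℂ => Complex.exp (2 * π * Complex.I * w / 1))
      (Complex.exp (2 * π * Complex.I * z / 1) * (2 * π * Complex.I)) z :=
    (Complex.hasDerivAt_exp _).comp z h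
  have e : (Function.Periodic.qParam 1 : ℂ → ℂ) = fun w => Complex.exp (2 * π * Complex.I * w / 1) := by
    funext w; simp [Function.Periodic.qParam]
  rw [e]
  refine h2.congr_deriv ?_
  show Complex.exp (2 * π * Complex.I * z / 1) * (2 * π * Complex.I) = 2 * π * Complex.I * Complex.exp (2 * π * Complex.I * z / 1)
  ring

omit [IsCancelSMul (Γ : Subgroup (GL (Fin 2) ℝ)) ℍ] in
/-- `det σ_i = 1`. [cite: Iwaniec2002, §2.2 (2.1)] -/
theorem det_frameGL (i : Fin (numCusps Γ)) : (frameGL Γ i).det = 1 := by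
  simp [frameGL]

omit [IsCancelSMul (Γ : Subgroup (GL (Fin 2) ℝ)) ℍ] in
/-- **The uniformiser at a cusp inverts the chart**: `π(σ_i z) = q_i⁻¹(e^{2πiz})` for `Im z > 1`. [cite: ShimuraIATAF1971, §1.5 Thm. 1.28 (proof)] -/
theorem toCpt_frameGL_smul_eq_symm_qParam (i : Fin (numCusps Γ)) {z : ℂ} (hz : 1 < z.im) :
    toCpt Γ (frameGL Γ i • UpperHalfPlane.ofComplex z) = (cuspChart Γ i).symm (Function.Periodic.qParam 1 z) := by
  have hz0 : 0 < z.im := lt_trans one_pos hz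
  have him : 1 < (UpperHalfPlane.ofComplex z).im := by
    rw [UpperHalfPlane.ofComplex_apply_of_im_pos hz0]; exact hz
  have hsrc : toCpt Γ (frameGL Γ i • UpperHalfPlane.ofComplex z) ∈ (cuspChart Γ i).source :=
    inl_proj_frameGL_smul_mem_cuspNhd Γ i him
  have hval : cuspChart Γ i (toCpt Γ (frameGL Γ i • UpperHalfPlane.ofComplex z)) = Function.Periodic.qParam 1 z := by
    rw [coe_cuspChart]
    change cuspCoord Γ i (inl Γ (proj Γ (frameGL Γ i • UpperHalfPlane.ofComplex z))) = _
    rw [cuspCoord_inl_proj Γ i him, UpperHalfPlane.ofComplex_apply_of_im_pos hz0, UpperHalfPlane.coe_mk]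
  rw [← hval, (cuspChart Γ i).left_inv hsrc]

omit [Γ.FiniteIndex] [IsCancelSMul (Γ : Subgroup (GL (Fin 2) ℝ)) ℍ] in
/-- `|e^{2πiz}| = e^{−2π Im z}` for `z : ℂ` (private; the tree has the `ℍ`-version elsewhere). [folklore] -/
private theorem norm_qParam_one' (z : ℂ) : ‖Function.Periodic.qParam 1 z‖ = Real.exp (-(2 * π * z.im)) := by
  rw [Function.Periodic.norm_qParam, div_one, neg_mul, neg_mul]

/-- **A primitive near the cusp, along the frame**: if `G` is a primitive of `ω` on `U ∋ π(σ_i z)`, `Im z > 1`, then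
`w ↦ G(π(σ_i w))` has derivative `ω_{q_i}(e^{2πiz}) · 2πi e^{2πiz}` at `z`. [cite: ShimuraIATAF1971, §2.1 Prop. 2.16 (proof)] -/
theorem hasDerivAt_primitive_comp_frame {G : Cpt Γ → ℂ} {U : Set (Cpt Γ)} (hG : θ.IsPrimitiveOn G U)
    (i : Fin (numCusps Γ)) {z : ℂ} (hz : 1 < z.im) (hU : toCpt Γ (frameGL Γ i • UpperHalfPlane.ofComplex z) ∈ U) :
    HasDerivAt (fun w : ℂ => G (toCpt Γ (frameGL Γ i • UpperHalfPlane.ofComplex w)))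
      (θ.localExpr (cuspChart Γ i) (Function.Periodic.qParam 1 z) * (2 * π * Complex.I * Function.Periodic.qParam 1 z)) z := by
  have hz0 : 0 < z.im := lt_trans one_pos hz
  have him : 1 < (UpperHalfPlane.ofComplex z).im := by
    rw [UpperHalfPlane.ofComplex_apply_of_im_pos hz0]; exact hz
  have hatlas : cuspChart Γ i ∈ atlas ℂ (Cpt Γ) := Or.inr ⟨i, rfl⟩
  have hsrc : toCpt Γ (frameGL Γ i • UpperHalfPlane.ofComplex z) ∈ (cuspChart Γ i).source :=
    inl_proj_frameGL_smul_mem_cuspNhd Γ i him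
  have hex : cuspChart Γ i (toCpt Γ (frameGL Γ i • UpperHalfPlane.ofComplex z)) = Function.Periodic.qParam 1 z := by
    rw [toCpt_frameGL_smul_eq_symm_qParam i hz]
    exact (cuspChart Γ i).right_inv (by
      rw [cuspChart_target, Metric.mem_ball, dist_zero_right, norm_qParam_one' z, Real.exp_lt_exp]
      nlinarith [Real.pi_pos])
  have hd : HasDerivAt (G ∘ (cuspChart Γ i).symm) (θ.localExpr (cuspChart Γ i) (Function.Periodic.qParam 1 z))
      (Function.Periodic.qParam 1 z) := by
    have h := hG hatlas hU hsrc
    rwa [hex] at h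
  have hcomp := hd.comp z (hasDerivAt_qParam_one z)
  refine hcomp.congr_of_eventuallyEq ?_
  have hev : ∀ᶠ w in 𝓝 z, 1 < w.im := Complex.continuous_im.continuousAt.eventually (lt_mem_nhds hz)
  filter_upwards [hev] with w hw
  show G (toCpt Γ (frameGL Γ i • UpperHalfPlane.ofComplex w)) = G ((cuspChart Γ i).symm (Function.Periodic.qParam 1 w))
  rw [toCpt_frameGL_smul_eq_symm_qParam i hw]

/-! ### `dF∕dz` vanishes at every cusp -/

/-- ★ **`dF∕dz ∣[2] σ_i → 0` at `i∞`** for the development `F` of a HOLOMORPHIC `ω`: beyond a horoball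
`{Im > T}` mapped into the domain of a primitive `G` at the cusp, `(dF∕dz ∣[2] σ_i)(w) = ω_{q_i}(e^{2πiw})·2πi e^{2πiw}`
with `ω_{q_i}` analytic (bounded) at `0`. [cite: ShimuraIATAF1971, §2.1 Prop. 2.16] [cite: DiamondShurman2005, §3.3] -/
theorem isZeroAtImInfty_devDeriv_slash_frameGL (hθ : θ.IsHolomorphic) (hF : θ.IsDevelopment (toCpt Γ) F) (i : Fin (numCusps Γ)) :
    IsZeroAtImInfty (devDeriv F ∣[(2 : ℤ)] (frameGL Γ i : GL (Fin 2) ℝ)) := by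
  -- a primitive `G` of `ω` near the cusp, and a horoball inside its domain
  obtain ⟨U, hUo, hcU, -, -, G, -, hG⟩ := MeromorphicOneForm.exists_isPrimitiveOn hθ (cuspPt Γ i)
  obtain ⟨T, hT1, hTU⟩ := (nhds_cuspPt_hasBasis Γ i).mem_iff.1 (hUo.mem_nhds hcU)
  -- the local expression `ω_{q_i}` is bounded near `0`
  have han : AnalyticAt ℂ (θ.localExpr (cuspChart Γ i)) 0 := by
    have h := hθ (cuspPt Γ i)
    rw [MeromorphicOneForm.isHolomorphicAt_iff, chartAt_cuspPt, cuspChart_cuspPt] at h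
    exact h
  obtain ⟨ρ, hρ, hρB⟩ := Metric.continuousAt_iff.1 han.continuousAt 1 one_pos
  set B : ℝ := ‖θ.localExpr (cuspChart Γ i) 0‖ + 1 with hB
  have hbound : ∀ q : ℂ, ‖q‖ < ρ → ‖θ.localExpr (cuspChart Γ i) q‖ ≤ B := fun q hq => by
    have h := hρB (by rwa [dist_zero_right])
    rw [dist_eq_norm] at h
    have := norm_le_norm_add_norm_sub' (θ.localExpr (cuspChart Γ i) q) (θ.localExpr (cuspChart Γ i) 0)
    linarith [norm_sub_rev (θ.localExpr (cuspChart Γ i) q) (θ.localExpr (cuspChart Γ i) 0)]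
  -- the derivative identity beyond `Im > T`
  have hderiv : ∀ z : ℂ, T < z.im →
      (devDeriv F ∣[(2 : ℤ)] (frameGL Γ i : GL (Fin 2) ℝ)) (UpperHalfPlane.ofComplex z) =
        θ.localExpr (cuspChart Γ i) (Function.Periodic.qParam 1 z) * (2 * π * Complex.I * Function.Periodic.qParam 1 z) := by
    intro z hz
    have hz1 : 1 < z.im := lt_of_le_of_lt hT1 hz
    have hz0 : 0 < z.im := lt_trans one_pos hz1
    set ψ : ℂ → ℍ := fun w => frameGL Γ i • UpperHalfPlane.ofComplex w with hψ
    have hψc : ContinuousAt ψ z :=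
      (continuous_const_smul _).continuousAt.comp (UpperHalfPlane.mdifferentiableAt_ofComplex hz0).continuousAt
    have himz : T < (UpperHalfPlane.ofComplex z).im := by rw [UpperHalfPlane.ofComplex_apply_of_im_pos hz0]; exact hz
    have hxU : toCpt Γ (ψ z) ∈ U := hTU (inl_proj_frameGL_smul_mem_cuspNhd Γ i himz)
    -- `F = G' ∘ toCpt` near `ψ z`, and `G' − G` is constant near `toCpt (ψ z)`
    obtain ⟨U', hU'o, hxU', G', hG', hFG'⟩ := hF (ψ z)
    have hsub : ∀ᶠ y in 𝓝 (toCpt Γ (ψ z)), G' y - G y = G' (toCpt Γ (ψ z)) - G (toCpt Γ (ψ z)) :=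
      (hG.mono inter_subset_left).sub_eventuallyEq (hG'.mono inter_subset_right) (hUo.inter hU'o) ⟨hxU, hxU'⟩
    set c₀ : ℂ := G' (toCpt Γ (ψ z)) - G (toCpt Γ (ψ z))
    have hev : (fun w => F (ψ w)) =ᶠ[𝓝 z] fun w => G (toCpt Γ (ψ w)) + c₀ := by
      have h1 : ∀ᶠ w in 𝓝 z, F (ψ w) = G' (toCpt Γ (ψ w)) := hψc.eventually hFG'
      have h2 : ∀ᶠ w in 𝓝 z, G' (toCpt Γ (ψ w)) - G (toCpt Γ (ψ w)) = c₀ :=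
        ((continuous_toCpt Γ).continuousAt.comp hψc).eventually hsub
      filter_upwards [h1, h2] with w hw1 hw2
      rw [hw1, ← hw2]; ring
    have hD₁ := hasDerivAt_comp_smul_slash hF (det_frameGL i) hz0
    have hD₂ := (hasDerivAt_primitive_comp_frame hG i hz1 hxU).add_const c₀
    exact (hD₁.congr_of_eventuallyEq hev.symm).unique hD₂
  -- conclusion
  rw [UpperHalfPlane.isZeroAtImInfty_iff]
  intro ε hε
  -- choose the height: `Im ≥ A` forces `|q| < ρ` and `2π B |q| ≤ ε`
  have hB0 : 0 < B := by positivity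
  set δ : ℝ := min ρ (ε / (2 * π * B)) with hδ
  have hδ0 : 0 < δ := lt_min hρ (by positivity)
  set A : ℝ := max (T + 1) (-Real.log δ / (2 * π) + 1) with hA
  refine ⟨A, fun τ hτ => ?_⟩
  have hτT : T < τ.im := by linarith [le_max_left (T + 1) (-Real.log δ / (2 * π) + 1)]
  have hq : ‖Function.Periodic.qParam 1 (τ : ℂ)‖ < δ := by
    rw [norm_qParam_one', UpperHalfPlane.coe_im, ← Real.lt_log_iff_exp_lt hδ0]
    have h2 : -Real.log δ / (2 * π) + 1 ≤ τ.im := (le_max_right _ _).trans hτ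
    have hπ : 0 < 2 * π := by positivity
    rw [div_add_one (ne_of_gt hπ), div_le_iff₀ hπ] at h2
    nlinarith
  have h := hderiv (τ : ℂ) (by rw [UpperHalfPlane.coe_im]; exact hτT)
  rw [UpperHalfPlane.ofComplex_apply] at h
  rw [h, norm_mul]
  have hL : ‖θ.localExpr (cuspChart Γ i) (Function.Periodic.qParam 1 (τ : ℂ))‖ ≤ B := hbound _ (hq.trans_le (min_le_left _ _))
  have h2q : ‖2 * (π : ℂ) * Complex.I * Function.Periodic.qParam 1 (τ : ℂ)‖ = 2 * π * ‖Function.Periodic.qParam 1 (τ : ℂ)‖ := by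
    rw [norm_mul, norm_mul, norm_mul, Complex.norm_I, mul_one, Complex.norm_real, Real.norm_eq_abs, abs_of_pos Real.pi_pos,
      Complex.norm_two]
  rw [h2q]
  have hqε : ‖Function.Periodic.qParam 1 (τ : ℂ)‖ ≤ ε / (2 * π * B) := hq.le.trans (min_le_right _ _)
  calc ‖θ.localExpr (cuspChart Γ i) (Function.Periodic.qParam 1 (τ : ℂ))‖ * (2 * π * ‖Function.Periodic.qParam 1 (τ : ℂ)‖)
      ≤ B * (2 * π * (ε / (2 * π * B))) := by gcongr
    _ = ε := by field_simp

/-! ### The pull-back cusp form -/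

/-- ★ **THE PULL-BACK CUSP FORM `f = dF∕dz ∈ S₂(Γ)`** of a holomorphic differential `ω` on `X(Γ)`: weight two,
holomorphic, `Γ`-invariant, and ZERO AT EVERY CUSP of `Γ` (each is `γσ_i∞`; Mathlib `OnePoint.isZeroAt_iff`).
[cite: ShimuraIATAF1971, §2.1 Prop. 2.16] [cite: DiamondShurman2005, §3.3] -/
def cuspFormOfDevelopment (hθ : θ.IsHolomorphic) (hF : θ.IsDevelopment (toCpt Γ) F) : CuspForm (Γ : Subgroup (GL (Fin 2) ℝ)) 2 where
  toFun := devDeriv F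
  slash_action_eq' := fun γ hγ => devDeriv_slash hF ⟨γ, hγ⟩
  holo' := mdifferentiable_devDeriv hF
  zero_at_cusps' := fun {c} hc => by
    obtain ⟨i, γ, hγ, h⟩ := exists_smul_cusp_eq Γ hc
    have hg : (γ * frameGL Γ i) • (OnePoint.infty : OnePoint ℝ) = c := by rw [mul_smul, frameGL_smul_infty, h]
    rw [OnePoint.isZeroAt_iff hg, SlashAction.slash_mul, devDeriv_slash hF ⟨γ, hγ⟩]
    exact isZeroAtImInfty_devDeriv_slash_frameGL hθ hF i

/-- The pull-back form as a function. [cite: ShimuraIATAF1971, §2.1] -/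
@[simp] theorem coe_cuspFormOfDevelopment (hθ : θ.IsHolomorphic) (hF : θ.IsDevelopment (toCpt Γ) F) :
    ⇑(cuspFormOfDevelopment hθ hF) = devDeriv F := rfl

/-- **Real periods of the pull-back are the real periods of the development**: `Re ∫_{z₀}^{γz₀} f = Re(F(γz₀) − F(z₀))`.
[cite: ShimuraIATAF1971, §8.2 (8.2.19)–(8.2.20)] -/
theorem rePeriod_cuspFormOfDevelopment (hθ : θ.IsHolomorphic) (hF : θ.IsDevelopment (toCpt Γ) F) (z₀ : ℍ)
    (γ : (Γ : Subgroup (GL (Fin 2) ℝ))) :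
    CuspForm.rePeriod (cuspFormOfDevelopment hθ hF) z₀ γ = (F (γ • z₀) - F z₀).re := by
  rw [CuspForm.rePeriod_apply,
    segmentIntegral_eq_sub (cuspFormOfDevelopment hθ hF) (g := F ∘ UpperHalfPlane.ofComplex)
      (fun z hz => hasDerivAt_of_isDevelopment hF hz) z₀ _]
  simp only [comp_apply, UpperHalfPlane.ofComplex_apply]
  rfl

/-- **Injectivity**: `cuspFormOfDevelopment ω = 0 ⇒ ω = 0`. [cite: ShimuraIATAF1971, §2.1 Prop. 2.16] -/
theorem eq_zero_of_cuspFormOfDevelopment_eq_zero (hθ : θ.IsHolomorphic) (hF : θ.IsDevelopment (toCpt Γ) F)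
    (h0 : cuspFormOfDevelopment hθ hF = 0) : θ = 0 := by
  refine eq_zero_of_devDeriv_eq_zero hθ hF ?_
  have h := congrArg (fun G : CuspForm (Γ : Subgroup (GL (Fin 2) ℝ)) 2 => (⇑G : ℍ → ℂ)) h0
  simpa using h

end ModularCurve

end Literature.NumberTheory.ModularForms

end
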